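import Literature.MathematicalPhysics.QuantumFieldTheory.YangMillsOS
import Literature.MathematicalPhysics.QuantumLattice.SchwingerOSCluster
import Literature.MathematicalPhysics.QuantumLattice.SchwartzTranslationCutoff

/-!
# Crux `LatticeGapOnTrajectory` (stmt-QuantumFields-10523), line `orbit-kantorovich-finite-size`:
# the transfer half reduced to clustering on a total set of test functions

Helper file (`--supports stmt-QuantumFields-10523`) for the registered stub `stub_transfer` (the
TRANSFER HALF of the crux: every OS datum `T` with `IsYangMillsFor r sch' T` along the scheme, up
to species renormalisations, has `T.HasMassGap Δ'`). Vocabulary-free (tree imports only), all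
proved; nothing is asserted about Wilson's lattice theory.

What transfers from the lattice is POSITIVITY, not constants (standing disproof, PROVER NOTE):
the lattice only ever pins `T.schwinger` on OFF-DIAGONAL REAL PRODUCT tensors (all
`IsYangMillsFor` constrains), with clustering constants that are continuous functionals of the
test functions (norms of OS vectors, i.e. values of `T.schwinger` itself), whereas
`OSData.HasMassGap` quantifies over ALL time-ordered `F, G`, all witnesses `H` and all times.
This file proves the topological passage:

* §1 anatomy: `hasMassGap_anti` (antitone in the rate), `hasMassGap_of_schwinger_eq_zero`
  (fibres whose `T` has vanishing `n ≥ 1` Schwinger functions — e.g. `c ≡ 0` — have every gap),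
  `eq_appendTensor_of_isAppendTensorOf` (the witness `H` is unique);
* §2 `hasMassGap_of_dense_clustering`: if `𝔖_{n+m}(ΘF* ⊗ T_t G) − 𝔖_n(ΘF*) 𝔖_m(G)` is
  bounded by `C(F, G) e^{−Δt}` for `F, G` in sets `D n`, `D m` whose closures contain the
  time-ordered test functions and for `t ≥ 0` in a dense set of times (an `M`-adic scheme
  reaches exactly the `M`-adic rationals), with `C` jointly continuous in `(F, G)`, then
  `T.HasMassGap Δ` — strong continuity of time translations, continuity of
  `T.schwinger _ _ : 𝓢 →L[ℂ] ℂ` and of `(F, G) ↦ ΘF* ⊗ T_t G` (`continuous_appendTensor`),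
  `closure (D n ×ˢ D m) = closure (D n) ×ˢ closure (D m)`;
* §3 lattice-facing algebra: `isTensorOf_osAdjoint_appendTensor_translateMulti` (`ΘF* ⊗ T_a G`
  of two real product tensors is the real product tensor of the reflected reversed resp.
  translated factors), `isTimeOrdered_of_isTensorOf_slabs`,
  `isOffDiagonal_osAdjoint_appendTensor_translateMulti_of_slabs` (factors in positive ordered
  time slabs ⇒ time-ordered, and the append tensors are off-diagonal, so `IsYangMillsFor`
  reaches them), and the fibre form `transferClause_of_dense_clustering` of §2.

Deliberately NOT here (see the stub report): density of the span of slab-ordered real product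
tensors among time-ordered test functions (the natural `D`; the tree's box engine
`mem_closure_span_boxTensors` needs a product-form partition of unity on top for the ordered
wedge), and every lattice-side input (torus transfer matrix, thermal control on the torus).

References: Osterwalder–Schrader 1973 §2–§3, 1975 §2; Glimm–Jaffe 1987 §6.1, §19.7;
Osterwalder–Seiler 1978 §2; `Cruxes/LatticeGapOnTrajectory/Disproof.lean` §4 and PROVER NOTE.
-/

open scoped SchwartzMap Topology
open Filter Set
open Literature.MathematicalPhysics.AQFT Literature.MathematicalPhysics.QuantumLattice
open Literature.MathematicalPhysics.QuantumFieldTheory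

noncomputable section

namespace Summit.QuantumFields.YangMills.Cruxes.LatticeGapOnTrajectory.OrbitKantorovichFiniteSize

namespace Transfer

/-! ## §1 Anatomy of `OSData.HasMassGap` -/

section Anatomy

variable {ι : Type} {d : ℕ} [NeZero d]

omit [NeZero d] in
/-- The witness `H` of `IsAppendTensorOf H F G` is unique: it is the tree's `F.appendTensor G`.
[folklore] -/
theorem eq_appendTensor_of_isAppendTensorOf {n m : ℕ}
    {H : 𝓢((Fin (n + m) → EuclideanSpace ℝ (Fin d)), ℂ)}
    {F : 𝓢((Fin n → EuclideanSpace ℝ (Fin d)), ℂ)} {G : 𝓢((Fin m → EuclideanSpace ℝ (Fin d)), ℂ)}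
    (hH : IsAppendTensorOf H F G) : H = F.appendTensor G := by
  ext x; rw [hH x, SchwartzMap.appendTensor_apply]

/-- **The mass-gap clause is antitone in the rate**: `T.HasMassGap Δ → Δ' ≤ Δ → T.HasMassGap Δ'`
(same constant; `e^{-Δt} ≤ e^{-Δ't}` for `t ≥ 0`). [folklore] -/
theorem hasMassGap_anti {T : OSData ι d} {Δ Δ' : ℝ} (h : T.HasMassGap Δ) (hle : Δ' ≤ Δ) :
    T.HasMassGap Δ' := by
  intro n m k k' F G hF hG
  obtain ⟨C, hC⟩ := h n m k k' F G hF hG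
  refine ⟨C, fun t ht H hH => (hC t ht H hH).trans ?_⟩
  have hC0 : 0 ≤ C :=
    nonneg_of_mul_nonneg_left ((norm_nonneg _).trans (hC t ht H hH)) (Real.exp_pos _)
  exact mul_le_mul_of_nonneg_left (Real.exp_le_exp.2 (by nlinarith)) hC0

/-- **Vanishing fibres have every gap**: if all Schwinger functions of positive degree of `T`
vanish (e.g. the vacuum-only datum, or any continuum limit taken with multiplicative
renormalisations `c ≡ 0`), then `T.HasMassGap Δ` for every `Δ` (degree `0`: by E0). [folklore] -/
theorem hasMassGap_of_schwinger_eq_zero (T : OSData ι d)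
    (h0 : ∀ n : ℕ, n ≠ 0 → ∀ k : Fin n → ι, T.schwinger n k = 0) (Δ : ℝ) : T.HasMassGap Δ := by
  intro n m k k' F G _ _
  refine ⟨0, fun t _ H hH => ?_⟩
  rw [zero_mul]
  refine le_of_eq (norm_eq_zero.2 (sub_eq_zero.2 ?_))
  rcases Nat.eq_zero_or_pos (n + m) with hnm | hnm
  · obtain ⟨rfl, rfl⟩ : n = 0 ∧ m = 0 := by omega
    refine (T.normalized (Fin.append (k ∘ Fin.rev) k') H).trans ?_
    rw [T.normalized (k ∘ Fin.rev) (osAdjoint F), T.normalized k' G, hH, translateMulti_apply]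
    congr 1
    all_goals exact congrArg _ (Subsingleton.elim _ _)
  · rw [h0 (n + m) hnm.ne']
    rcases Nat.eq_zero_or_pos n with rfl | hn
    · rw [h0 m (by omega) k']; simp
    · rw [h0 n hn.ne']; simp

end Anatomy

/-! ## §2 The density reduction -/

section Density

variable {ι : Type} {d : ℕ} [NeZero d]

/-- The OS adjoint `F ↦ ΘF*` is continuous on `𝓢` (composition of the tree's CLMs). [folklore] -/
theorem continuous_osAdjoint {n : ℕ} : Continuous (osAdjoint :
    𝓢((Fin n → EuclideanSpace ℝ (Fin d)), ℂ) → 𝓢((Fin n → EuclideanSpace ℝ (Fin d)), ℂ)) := by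
  have h : (osAdjoint :
      𝓢((Fin n → EuclideanSpace ℝ (Fin d)), ℂ) → 𝓢((Fin n → EuclideanSpace ℝ (Fin d)), ℂ)) =
      fun F => thetaMulti d (osStar F) := funext fun F => (thetaMulti_osStar F).symm
  rw [h]
  exact (thetaMulti d).continuous.comp continuous_osStar

/-- Joint continuity of `(F, G) ↦ ΘF* ⊗ T_a G`. [folklore] -/
theorem continuous_osAdjoint_appendTensor_translateMulti {n m : ℕ} (a : EuclideanSpace ℝ (Fin d)) :
    Continuous fun p : 𝓢((Fin n → EuclideanSpace ℝ (Fin d)), ℂ) ×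
        𝓢((Fin m → EuclideanSpace ℝ (Fin d)), ℂ) =>
      (osAdjoint p.1).appendTensor (translateMulti a p.2) :=
  continuous_appendTensor.comp ((continuous_osAdjoint.comp continuous_fst).prodMk
    ((translateMulti a).continuous.comp continuous_snd))

omit [NeZero d] in
/-- A bound `‖f t‖ ≤ C e^{-Δt}` for a continuous `f` at the positive times of a dense set holds at
all `t ≥ 0` (the good set is closed and `[0, ∞) = closure ((0, ∞) ∩ Tm)`). [folklore] -/
theorem norm_le_mul_exp_of_dense {f : ℝ → ℂ} (hf : Continuous f) {C Δ : ℝ} {Tm : Set ℝ}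
    (hTm : Dense Tm) (h : ∀ t ∈ Tm, 0 < t → ‖f t‖ ≤ C * Real.exp (-Δ * t)) {t : ℝ}
    (ht : 0 ≤ t) : ‖f t‖ ≤ C * Real.exp (-Δ * t) := by
  have hcl : IsClosed {s : ℝ | ‖f s‖ ≤ C * Real.exp (-Δ * s)} :=
    isClosed_le (continuous_norm.comp hf)
      (continuous_const.mul (Real.continuous_exp.comp (continuous_const.mul continuous_id)))
  have hsub : Ioi (0 : ℝ) ∩ Tm ⊆ {s : ℝ | ‖f s‖ ≤ C * Real.exp (-Δ * s)} :=
    fun s hs => h s hs.2 hs.1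
  have ht' : t ∈ closure (Ioi (0 : ℝ) ∩ Tm) := by
    rw [← closure_closure]
    exact closure_mono (hTm.open_subset_closure_inter isOpen_Ioi) (by rwa [closure_Ioi])
  simpa only [Set.mem_setOf_eq] using hcl.closure_subset_iff.2 hsub ht'

/-- Time translation `t ↦ T_t G` along the time axis is continuous into `𝓢` (strong continuity
of translations, the tree's `continuous_compSubConstCLM`). [folklore] -/
theorem continuous_translateMulti_single {m : ℕ}
    (G : 𝓢((Fin m → EuclideanSpace ℝ (Fin d)), ℂ)) :
    Continuous fun t : ℝ => translateMulti (EuclideanSpace.single (0 : Fin d) t) G := by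
  have hc : Continuous fun t : ℝ =>
      (EuclideanSpace.single (0 : Fin d) t : EuclideanSpace ℝ (Fin d)) := by
    change Continuous fun t : ℝ => WithLp.toLp 2 (Pi.single (M := fun _ : Fin d => ℝ) 0 t)
    exact (PiLp.continuous_toLp 2 _).comp (continuous_single (A := fun _ : Fin d => ℝ) 0 :)
  change Continuous fun t : ℝ => SchwartzMap.compSubConstCLM ℂ
    (fun _ : Fin m => (EuclideanSpace.single (0 : Fin d) t : EuclideanSpace ℝ (Fin d))) G
  exact (continuous_compSubConstCLM ℂ G).comp (continuous_pi fun _ => hc)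

/-- **Density reduction for the full-spectrum mass gap.** Let `D n ⊆ 𝓢((ℝ^d)^n)` be sets whose
closures contain every time-ordered test function, `Tm ⊆ ℝ` a dense set of times (e.g. the
`M`-adic rationals an `M`-adic lattice scheme reaches exactly) and `C n m k k' F G` constants
jointly continuous in `(F, G)`. If
`‖𝔖_{n+m}^{rev k ++ k'}(ΘF* ⊗ T_t G) − 𝔖_n^{rev k}(ΘF*) 𝔖_m^{k'}(G)‖ ≤ C(F, G) e^{−Δt}` for
`F ∈ D n`, `G ∈ D m`, `t ∈ Tm`, `t ≥ 0`, then `T.HasMassGap Δ` (same constants; all `t ≥ 0`, all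
time-ordered `F, G`, all witnesses `H`): the witness is `ΘF* ⊗ T_t G`
(`eq_appendTensor_of_isAppendTensorOf`); for fixed `(F, G) ∈ D n × D m` the good times form a
closed set containing `Tm ∩ (0, ∞)` (`norm_le_mul_exp_of_dense`,
`continuous_translateMulti_single`); for fixed `t` the good pairs form a closed set
(`T.schwinger _ _` is a `→L[ℂ]`, `continuous_appendTensor`) containing `D n ×ˢ D m`, hence
`closure (D n) ×ˢ closure (D m) ∋ (F, G)`. Per-pair constants survive the limit only in this
pair-continuous form. [cite: GlimmJaffe1987, §6.1 Thm. 6.1.3 and §19.7] -/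
theorem hasMassGap_of_dense_clustering (T : OSData ι d) (Δ : ℝ)
    (D : (n : ℕ) → Set 𝓢((Fin n → EuclideanSpace ℝ (Fin d)), ℂ))
    (hD : ∀ (n : ℕ) (F : 𝓢((Fin n → EuclideanSpace ℝ (Fin d)), ℂ)),
      IsTimeOrdered F → F ∈ closure (D n))
    (Tm : Set ℝ) (hTm : Dense Tm)
    (C : (n m : ℕ) → (Fin n → ι) → (Fin m → ι) → 𝓢((Fin n → EuclideanSpace ℝ (Fin d)), ℂ) →
      𝓢((Fin m → EuclideanSpace ℝ (Fin d)), ℂ) → ℝ)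
    (hC : ∀ (n m : ℕ) (k : Fin n → ι) (k' : Fin m → ι),
      Continuous fun p : 𝓢((Fin n → EuclideanSpace ℝ (Fin d)), ℂ) ×
        𝓢((Fin m → EuclideanSpace ℝ (Fin d)), ℂ) => C n m k k' p.1 p.2)
    (h : ∀ (n m : ℕ) (k : Fin n → ι) (k' : Fin m → ι)
      (F : 𝓢((Fin n → EuclideanSpace ℝ (Fin d)), ℂ)) (G : 𝓢((Fin m → EuclideanSpace ℝ (Fin d)), ℂ)),
      F ∈ D n → G ∈ D m → ∀ t ∈ Tm, 0 ≤ t →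
        ‖T.schwinger (n + m) (Fin.append (k ∘ Fin.rev) k')
              ((osAdjoint F).appendTensor (translateMulti (EuclideanSpace.single 0 t) G)) -
            T.schwinger n (k ∘ Fin.rev) (osAdjoint F) * T.schwinger m k' G‖ ≤
          C n m k k' F G * Real.exp (-Δ * t)) :
    T.HasMassGap Δ := by
  intro n m k k' F G hF hG
  refine ⟨C n m k k' F G, fun t ht H hH => ?_⟩
  rw [eq_appendTensor_of_isAppendTensorOf hH]
  -- the truncated quantity as a function of the pair and of the time
  let Φ : 𝓢((Fin n → EuclideanSpace ℝ (Fin d)), ℂ) × 𝓢((Fin m → EuclideanSpace ℝ (Fin d)), ℂ) →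
      ℝ → ℂ := fun p s =>
    T.schwinger (n + m) (Fin.append (k ∘ Fin.rev) k')
        ((osAdjoint p.1).appendTensor (translateMulti (EuclideanSpace.single 0 s) p.2)) -
      T.schwinger n (k ∘ Fin.rev) (osAdjoint p.1) * T.schwinger m k' p.2
  -- Step 1: on `D n ×ˢ D m` the bound extends from `Tm` to all `t ≥ 0`
  have hA : ∀ p ∈ D n ×ˢ D m, ∀ s : ℝ, 0 ≤ s → ‖Φ p s‖ ≤ C n m k k' p.1 p.2 * Real.exp (-Δ * s) :=
    fun p hp s hs => norm_le_mul_exp_of_dense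
      (((T.schwinger (n + m) (Fin.append (k ∘ Fin.rev) k')).continuous.comp
        (continuous_appendTensor.comp (continuous_const.prodMk
          (continuous_translateMulti_single p.2)))).sub continuous_const)
      hTm (fun t htm ht0 => h n m k k' p.1 p.2 hp.1 hp.2 t htm ht0.le) hs
  -- Step 2: both sides of the bound are continuous in the pair `(F, G)`
  have hΦ : Continuous fun p => Φ p t := by
    refine Continuous.sub ?_ (Continuous.mul ?_ ?_)
    · exact (T.schwinger (n + m) (Fin.append (k ∘ Fin.rev) k')).continuous.comp
        (continuous_osAdjoint_appendTensor_translateMulti (EuclideanSpace.single 0 t))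
    · exact (T.schwinger n (k ∘ Fin.rev)).continuous.comp
        (continuous_osAdjoint.comp continuous_fst)
    · exact (T.schwinger m k').continuous.comp continuous_snd
  have hclosed : IsClosed {p | ‖Φ p t‖ ≤ C n m k k' p.1 p.2 * Real.exp (-Δ * t)} :=
    isClosed_le (continuous_norm.comp hΦ) ((hC n m k k').mul continuous_const)
  have hsub : D n ×ˢ D m ⊆ {p | ‖Φ p t‖ ≤ C n m k k' p.1 p.2 * Real.exp (-Δ * t)} :=
    fun p hp => hA p hp t ht
  have hmem : (F, G) ∈ closure (D n ×ˢ D m) := by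
    rw [closure_prod_eq]; exact ⟨hD n F hF, hD m G hG⟩
  simpa only [Set.mem_setOf_eq] using hclosed.closure_subset_iff.2 hsub hmem

end Density

/-! ## §3 The lattice-facing algebra and the fibre form of the reduction -/

section Fibre

variable {d : ℕ} [NeZero d]

/-- **`ΘF* ⊗ T_a G` of two real product tensors is a real product tensor**: its factors are the
time-reflected reversed factors of `F` followed by the translated factors of `G`. Hence the
append tensors entering `OSData.HasMassGap` for product `F, G` have exactly the shape
`IsYangMillsFor` constrains (once off-diagonal). [cite: OsterwalderSchraderCMP1973, §2 (2.4)] -/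
theorem isTensorOf_osAdjoint_appendTensor_translateMulti {n m : ℕ}
    {F : 𝓢((Fin n → EuclideanSpace ℝ (Fin d)), ℂ)} {G : 𝓢((Fin m → EuclideanSpace ℝ (Fin d)), ℂ)}
    {f : Fin n → 𝓢(EuclideanSpace ℝ (Fin d), ℝ)} {g : Fin m → 𝓢(EuclideanSpace ℝ (Fin d), ℝ)}
    (hF : IsTensorOf F fun i => ofRealTest (f i)) (hG : IsTensorOf G fun j => ofRealTest (g j))
    (a : EuclideanSpace ℝ (Fin d)) :
    IsTensorOf ((osAdjoint F).appendTensor (translateMulti a G)) fun i => ofRealTest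
      (Fin.append (fun i => thetaTest d (f (Fin.rev i))) (fun j => translateTest a (g j)) i) := by
  have h := (hF.osAdjoint).appendTensor (hG.translateMulti a)
  rwa [append_ofRealTest] at h

omit [NeZero d] in
/-- Support of a complexified real test function. [folklore] -/
theorem tsupport_ofRealTest_subset (φ : 𝓢(EuclideanSpace ℝ (Fin d), ℝ)) :
    tsupport (ofRealTest φ : EuclideanSpace ℝ (Fin d) → ℂ) ⊆
      tsupport (φ : EuclideanSpace ℝ (Fin d) → ℝ) :=
  tsupport_comp_subset (g := fun t : ℝ => (t : ℂ)) Complex.ofReal_zero _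

/-- Support of a time-reflected test function: `supp (θφ) ⊆ θ⁻¹(supp φ)`. [folklore] -/
theorem tsupport_thetaTest_subset (φ : 𝓢(EuclideanSpace ℝ (Fin d), ℝ)) :
    tsupport (thetaTest d φ : EuclideanSpace ℝ (Fin d) → ℝ) ⊆
      timeReflection d ⁻¹' tsupport (φ : EuclideanSpace ℝ (Fin d) → ℝ) := by
  rw [show (thetaTest d φ : EuclideanSpace ℝ (Fin d) → ℝ) = fun y => φ (timeReflection d y) from
    funext fun y => thetaTest_apply d φ y]
  exact tsupport_schwartz_comp_subset φ (timeReflection d).continuous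

omit [NeZero d] in
/-- Support of a translated test function: `supp (T_a φ) ⊆ (· - a)⁻¹(supp φ)`. [folklore] -/
theorem tsupport_translateTest_subset (a : EuclideanSpace ℝ (Fin d))
    (φ : 𝓢(EuclideanSpace ℝ (Fin d), ℝ)) :
    tsupport (translateTest a φ : EuclideanSpace ℝ (Fin d) → ℝ) ⊆
      (fun y => y - a) ⁻¹' tsupport (φ : EuclideanSpace ℝ (Fin d) → ℝ) := by
  rw [show (translateTest a φ : EuclideanSpace ℝ (Fin d) → ℝ) = fun y => φ (y - a) from
    funext fun y => translateTest_apply a φ y]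
  exact tsupport_schwartz_comp_subset φ (continuous_id.sub continuous_const)

/-- **Slab-ordered real product tensors are time-ordered.** If `F = f₁ ⊗ ⋯ ⊗ fₙ` with real
factors supported in closed time slabs `lo i ≤ x⁰ ≤ hi i` that are positive (`0 < lo i`) and
ordered (`hi i < lo j` for `i < j`), then `F ∈ 𝒮(ℝ^{dn}_< ∩ ℝ^{dn}_+)` (`IsTimeOrdered`), in
particular `F ∈ ⁰𝒮`. [cite: OsterwalderSchraderCMP1973, §2] -/
theorem isTimeOrdered_of_isTensorOf_slabs {n : ℕ} {F : 𝓢((Fin n → EuclideanSpace ℝ (Fin d)), ℂ)}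
    {f : Fin n → 𝓢(EuclideanSpace ℝ (Fin d), ℝ)} (hF : IsTensorOf F fun i => ofRealTest (f i))
    {lo hi : Fin n → ℝ} (hlo : ∀ i, 0 < lo i) (hord : ∀ i j, i < j → hi i < lo j)
    (hsupp : ∀ i, tsupport (f i : EuclideanSpace ℝ (Fin d) → ℝ) ⊆ {x | lo i ≤ x 0 ∧ x 0 ≤ hi i}) :
    IsTimeOrdered F := by
  intro x hx
  have hxi : ∀ i, lo i ≤ x i 0 ∧ x i 0 ≤ hi i := fun i =>
    hsupp i (tsupport_ofRealTest_subset (f i) (hF.tsupport_subset hx i))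
  refine ⟨fun i => (hlo i).trans_le (hxi i).1, fun i j hij => ?_⟩
  exact (hxi i).2.trans_lt ((hord i j hij).trans_le (hxi j).1)

/-- **The append tensor `ΘF* ⊗ T_t G` of two slab-ordered real product tensors is off-diagonal**
(`t ≥ 0`): the reflected factors live at negative times `-hi i ≤ x⁰ ≤ -lo i` in reversed order,
the translated ones at positive times `lo' j + t ≤ x⁰ ≤ hi' j + t`, so all time coordinates on
the support are pairwise distinct — every append tensor the transfer argument evaluates is within
reach of `IsYangMillsFor`. [cite: OsterwalderSchraderCMP1973, §2 (2.4)] -/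
theorem isOffDiagonal_osAdjoint_appendTensor_translateMulti_of_slabs {n m : ℕ}
    {F : 𝓢((Fin n → EuclideanSpace ℝ (Fin d)), ℂ)} {G : 𝓢((Fin m → EuclideanSpace ℝ (Fin d)), ℂ)}
    {f : Fin n → 𝓢(EuclideanSpace ℝ (Fin d), ℝ)} {g : Fin m → 𝓢(EuclideanSpace ℝ (Fin d), ℝ)}
    (hF : IsTensorOf F fun i => ofRealTest (f i)) (hG : IsTensorOf G fun j => ofRealTest (g j))
    {lo hi : Fin n → ℝ} {lo' hi' : Fin m → ℝ} (hlo : ∀ i, 0 < lo i) (hlo' : ∀ j, 0 < lo' j)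
    (hord : ∀ i j, i < j → hi i < lo j) (hord' : ∀ i j, i < j → hi' i < lo' j)
    (hsupp : ∀ i, tsupport (f i : EuclideanSpace ℝ (Fin d) → ℝ) ⊆ {x | lo i ≤ x 0 ∧ x 0 ≤ hi i})
    (hsupp' : ∀ j,
      tsupport (g j : EuclideanSpace ℝ (Fin d) → ℝ) ⊆ {x | lo' j ≤ x 0 ∧ x 0 ≤ hi' j})
    {t : ℝ} (ht : 0 ≤ t) :
    IsOffDiagonal ((osAdjoint F).appendTensor (translateMulti (EuclideanSpace.single 0 t) G)) := by
  have hT := isTensorOf_osAdjoint_appendTensor_translateMulti hF hG (EuclideanSpace.single 0 t)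
  -- lower and upper time bounds of the factors of the append tensor
  let L : Fin (n + m) → ℝ := Fin.append (fun i => -hi (Fin.rev i)) (fun j => lo' j + t)
  let U : Fin (n + m) → ℝ := Fin.append (fun i => -lo (Fin.rev i)) (fun j => hi' j + t)
  have hLU : ∀ i j : Fin (n + m), i < j → U i < L j := by
    intro i j hij
    have hv := Fin.lt_def.1 hij
    induction i using Fin.addCases with
    | left i =>
      induction j using Fin.addCases with
      | left j =>
        simp only [U, L, Fin.append_left]
        simp only [Fin.val_castAdd] at hv
        have hij' : Fin.rev j < Fin.rev i := Fin.rev_lt_rev.2 (Fin.lt_def.2 hv)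
        linarith [hord (Fin.rev j) (Fin.rev i) hij']
      | right j =>
        simp only [U, L, Fin.append_left, Fin.append_right]
        linarith [hlo (Fin.rev i), hlo' j]
    | right i =>
      induction j using Fin.addCases with
      | left j =>
        exfalso
        simp only [Fin.val_castAdd, Fin.val_natAdd] at hv
        omega
      | right j =>
        simp only [U, L, Fin.append_right]
        simp only [Fin.val_natAdd] at hv
        have hij' : i < j := Fin.lt_def.2 (by omega)
        linarith [hord' i j hij']
  refine IsOffDiagonal.of_tsupport_subset fun x hx => ?_
  have hxi : ∀ i, L i ≤ x i 0 ∧ x i 0 ≤ U i := by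
    intro i
    have hmem := tsupport_ofRealTest_subset _ (hT.tsupport_subset hx i)
    induction i using Fin.addCases with
    | left i =>
      simp only [L, U, Fin.append_left] at hmem ⊢
      have h1 : lo (Fin.rev i) ≤ timeReflection d (x (Fin.castAdd m i)) 0 ∧
          timeReflection d (x (Fin.castAdd m i)) 0 ≤ hi (Fin.rev i) :=
        hsupp (Fin.rev i) (tsupport_thetaTest_subset _ hmem)
      rw [timeReflection_apply, if_pos rfl] at h1
      constructor <;> linarith [h1.1, h1.2]
    | right j =>
      simp only [L, U, Fin.append_right] at hmem ⊢
      have h1 : lo' j ≤ (x (Fin.natAdd n j) - EuclideanSpace.single (0 : Fin d) t :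
            EuclideanSpace ℝ (Fin d)) 0 ∧ (x (Fin.natAdd n j) - EuclideanSpace.single (0 : Fin d) t :
            EuclideanSpace ℝ (Fin d)) 0 ≤ hi' j :=
        hsupp' j (tsupport_translateTest_subset _ _ hmem)
      rw [PiLp.sub_apply, PiLp.single_apply, if_pos rfl] at h1
      constructor <;> linarith [h1.1, h1.2]
  refine not_mem_coincidenceLocus_of_injective fun i j hij => ?_
  have h0 : x i 0 = x j 0 := by rw [hij]
  by_contra hne
  rcases lt_or_gt_of_ne hne with hlt | hlt
  · linarith [(hxi i).2, (hxi j).1, hLU i j hlt]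
  · linarith [(hxi j).2, (hxi i).1, hLU j i hlt]

variable {G : Type} [Group G] [MeasurableSpace G] [TopologicalSpace G] [IsTopologicalGroup G]
  [CompactSpace G] [BorelSpace G]

/-- **The transfer clause of the crux reduced to clustering on a total set** (fibre form of
`hasMassGap_of_dense_clustering`): fix sets `D n` of test functions dense around the
time-ordered ones and a dense set of times `Tm`. If every OS datum `T` in the fibre of `sch`
(same `a, β, L`, any species renormalisations) that IS Yang–Mills clusters at rate `Δ` on `D` at
the times of `Tm`, with constants jointly continuous in the pair of test functions, then the
crux's last clause holds at rate `Δ`: `∀ sch' ~ sch, ∀ T, IsYangMillsFor r sch' T → T.HasMassGap Δ`.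
The lattice (positivity of the transfer matrix, `IsYangMillsFor` on the off-diagonal real product
tensors of §3) has to supply exactly the displayed hypothesis — nothing about general
time-ordered `F, G`, general witnesses `H` or general times. [folklore] -/
theorem transferClause_of_dense_clustering (r : LatticeRep G) (sch : SpeciesScheme (YMSpecies G))
    (Δ : ℝ) (D : (n : ℕ) → Set 𝓢((Fin n → EuclideanSpace ℝ (Fin 4)), ℂ))
    (hD : ∀ (n : ℕ) (F : 𝓢((Fin n → EuclideanSpace ℝ (Fin 4)), ℂ)),
      IsTimeOrdered F → F ∈ closure (D n))
    (Tm : Set ℝ) (hTm : Dense Tm)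
    (h : ∀ sch' : SpeciesScheme (YMSpecies G), sch'.a = sch.a → sch'.β = sch.β → sch'.L = sch.L →
      ∀ T : OSData (YMSpecies G) 4, IsYangMillsFor r sch' T →
        ∃ C : (n m : ℕ) → (Fin n → YMSpecies G) → (Fin m → YMSpecies G) →
            𝓢((Fin n → EuclideanSpace ℝ (Fin 4)), ℂ) → 𝓢((Fin m → EuclideanSpace ℝ (Fin 4)), ℂ) → ℝ,
          (∀ (n m : ℕ) (k : Fin n → YMSpecies G) (k' : Fin m → YMSpecies G),
            Continuous fun p : 𝓢((Fin n → EuclideanSpace ℝ (Fin 4)), ℂ) ×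
              𝓢((Fin m → EuclideanSpace ℝ (Fin 4)), ℂ) => C n m k k' p.1 p.2) ∧
          ∀ (n m : ℕ) (k : Fin n → YMSpecies G) (k' : Fin m → YMSpecies G)
            (F : 𝓢((Fin n → EuclideanSpace ℝ (Fin 4)), ℂ))
            (G' : 𝓢((Fin m → EuclideanSpace ℝ (Fin 4)), ℂ)),
            F ∈ D n → G' ∈ D m → ∀ t ∈ Tm, 0 ≤ t →
              ‖T.schwinger (n + m) (Fin.append (k ∘ Fin.rev) k')
                    ((osAdjoint F).appendTensor (translateMulti (EuclideanSpace.single 0 t) G')) -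
                  T.schwinger n (k ∘ Fin.rev) (osAdjoint F) * T.schwinger m k' G'‖ ≤
                C n m k k' F G' * Real.exp (-Δ * t)) :
    ∀ sch' : SpeciesScheme (YMSpecies G), sch'.a = sch.a → sch'.β = sch.β → sch'.L = sch.L →
      ∀ T : OSData (YMSpecies G) 4, IsYangMillsFor r sch' T → T.HasMassGap Δ := by
  intro sch' ha hβ hL T hT
  obtain ⟨C, hC, hb⟩ := h sch' ha hβ hL T hT
  exact hasMassGap_of_dense_clustering T Δ D hD Tm hTm C hC hb

end Fibre

end Transfer

end Summit.QuantumFields.YangMills.Cruxes.LatticeGapOnTrajectory.OrbitKantorovichFiniteSize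

end
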